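import Summits.QuantumFields.BalabanUV.Beta.SecondOrderBorderCocycle
import Summits.QuantumFields.BalabanUV.Beta.SecondOrderBorderGaugeWall
import Summits.QuantumFields.BalabanUV.Beta.SecondOrderLetterLevels

/-!
# `BalabanUV.Beta.SecondOrderBorderModel` — binder row D1, (L4): **A MODEL OF THE hR BORDER SOCKET** — ONE anti-twin, `ff`/`mm`-free border table
# satisfying the END's border letter (hBe) AT LEVEL `0` FOR ALL FOUR AXES (β sub-cell, row BETA-an2 = BINDER-OWNERS row D1 OWNER, lineage an2
# gen 20, K-L2 part 2)

HONEST FRAMING (cell charter, verbatim): «discharging BetaPertH makes Balaban's UV stability UNCONDITIONAL — a real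
constructive-QFT result; it is NOT the continuum limit and NOT the Clay problem.»  Neutral kernel algebra ([folklore]), entrywise; no statement
of Bałaban's papers, no `[cite:]`, no `Prop` fact; instantiates no binder of the wall.  NOT D1, NOT `BetaPertH`, NOT continuum, NOT Clay.

WHAT (`d + 1 = 4`, odd `Lc`, centred root `ρ_c`, pins `(cE, cVH) = (Lc⁴, −Lc⁸∕2)`, the END's `γ` with `hγ`):
* §1 (generic `d`) **`refK_bhKAt_inl_inr` / `refK_bhKAt_inr_inl`**: the BORDER blocks of the rooted bordered Hessian at the centred root are
  invariant under every axis relabelling `refK (Φ L α)` (an5's `linCountAt_fref`; the `ff` block is never needed).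
* §2 **`comm_wallD₀_inl_inr` / `_inr_inl`**: the level-0 border contacts of two axes satisfy the COCYCLE identity on the border blocks
  (`SecondOrderBorderCocycle.comm_canonD_of_laws` with `actS_SpureRecAt_zero`, `ctGen_fref_of_ne`, §1); `Bwall α := bdB (wallD₀ … α)`,
  `actB_Bwall` (anti-invariance), **`comm_Bwall`** (the cocycle identity as an equality of bi-tables).
* §3 **THE TABLE**: `Twall := stepB 3 (Bwall 3) (stepB 2 (Bwall 2) (stepB 1 (Bwall 1) (stepB 0 (Bwall 0) 0)))` and **`Twall_solves`**:
  `∀ α, actB Lc α Twall − Twall = Bwall α`; `Twall` has no `ff`/`mm` block and is anti-twin on the border.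
* §4 **`vh₂SModel := cB⁻¹ • Twall`** and **`borderAt_zero_vh₂SModel : BorderAt Lc ρ_c cΛ cB γ vh₂SModel 0`** — K-I's (hBe) at `j := 0` VERBATIM
  (an3's `SecondOrderLetterLevels.BorderAt`), hence `∀ j` by `border_all_of_zero`; with the END's shape lemmas `vh₂SModel_inl_inl` (hB0),
  `vh₂SModel_antiTwin` (hBat), `vh₂SModel_inr_inr` (hBmm0).
CONSEQUENCE (reading): the border socket of the hR END is CONSISTENT — it has a model (the positive twin of an2-g19's no-TWIN-model theorem).
HONEST: `vh₂SModel` is NOT shown to be Bałaban's second-order border jet; an1's table `T₁` satisfies the letter iff `cB•T₁ − Twall` is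
reflection-invariant on the border (`SecondOrderBorderGauge.solution_iff`).  The `LocStencil₂`/translation class of `Twall` and the END
corollary are K-L2 part 3.  0∕4 binders.
Provenance: β sub-cell, unit beta-an2 gen 20, 2026-08-20 (v1); no existing file touched.
-/

open Finset
open scoped BigOperators
open Literature.Probability.LatticeModels (Torus.proj)
open Literature.MathematicalPhysics.QuantumFieldTheory
open Literature.MathematicalPhysics.QuantumFieldTheory.Balaban1983to89
open Literature.MathematicalPhysics.QuantumFieldTheory.Balaban1983to89.Beta
open ExpKernelCalculus (MKer)
open AffineAveraging (box toSite)
open AveragingContoursRooted (ctr ctrOff ctrOff_mem_box linAvgAt)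
open AveragingHessianKernels (Bond)
open AveragingHessianKernelsRooted (linCountAt)
open PolarizationSign (reflSign)
open KernelReflection (LegMap refK refK_apply)
open ResolventReflection (sref bref bref_bref mref mref_zsmul Φ Φ_r_inl Φ_r_inr Φ_s_inl Φ_s_inr reflSign_mul_self reflSign_self
  reflSign_of_ne proj_mref_eq_zero_iff)
open RootedKernelReflection (fref zsgn cast_zsgn linCountAt_fref)
open KKTFluctuationKernel (delta1)
open LatticeForm (quo)
open OneStepResolventKernel (Fib quo_zsmul eq_zsmul_quo_of_proj)
open BalabanStepJetsSucc (wVH)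
open BalabanStepW2 (wB2)
open Summit.QuantumFields.BalabanUV.Beta.TameKernelCalculus
open Summit.QuantumFields.BalabanUV.Beta.ChartConjugation (conjV conjW)
open Summit.QuantumFields.BalabanUV.Beta.BorderedHessian (diagK ctGen bhKAt bhKAt_inl_inr bhKAt_inr_inl bhKStepAt bhKStepAt_zero stepScale
  linAvgAt_delta1_eq_cast sgnK)
open Summit.QuantumFields.BalabanUV.Beta.BorderedHessianStepParity (trK_bhKStepAt)
open Summit.QuantumFields.BalabanUV.Beta.SpineRecursivePureParity (trK_SpureRecAt_zero)
open Summit.QuantumFields.BalabanUV.Beta.SecondOrderBorderParity (twin_of_parityOdd)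
open Summit.QuantumFields.BalabanUV.Beta.SecondOrderBorderNoModel (antiTwin_of_parityEven conjW_canon_antiTwin)
open Summit.QuantumFields.BalabanUV.Beta.SpineRooted (SpureRecAt)
open Summit.QuantumFields.BalabanUV.Beta.SecondOrderBorderGauge
open Summit.QuantumFields.BalabanUV.Beta.SecondOrderBorderGaugeWall
open Summit.QuantumFields.BalabanUV.Beta.SecondOrderBorderCocycle
open Summit.QuantumFields.BalabanUV.Beta.SecondOrderLetterLevels (BorderAt)

namespace Summit.QuantumFields.BalabanUV.Beta.SecondOrderBorderModel

noncomputable section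

variable {d : ℕ}

/-! ## §1 The border blocks of the rooted bordered Hessian are reflection-invariant (centred root, odd `L`) -/

/-- [folklore] The rooted linearised averaging at a reflected coarse bond and a reflected fine bond (pure sign law, in `ℝ`). -/
theorem linAvgAt_delta1_fref {L : ℕ} (hL : Odd L) (α β m : Fin (d + 1)) (x q : Fin (d + 1) → ℤ) :
    linAvgAt (toSite (ctrOff (d + 1) L)) (delta1 β (bref α β x)) L m (bref α m q) =
      reflSign α β * reflSign α m * linAvgAt (toSite (ctrOff (d + 1) L)) (delta1 β x) L m q := by
  rw [linAvgAt_delta1_eq_cast, linAvgAt_delta1_eq_cast]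
  have e := linCountAt_fref hL α m (bref α m q) (β, x)
  rw [bref_bref] at e
  rw [show ((β, bref α β x) : Bond (d + 1)) = fref α (β, x) from rfl,
    show (toSite (ctrOff (d + 1) L) : Fin (d + 1) → ℤ) = ctr (d + 1) L from rfl, e]
  simp only [Int.cast_mul, cast_zsgn]

/-- [folklore] **THE FIELD–MULTIPLIER BLOCK OF `bhKAt ρ_c L` IS `refK (Φ L α)`-INVARIANT.** -/
theorem refK_bhKAt_inl_inr {L : ℕ} [NeZero L] (hL : Odd L) (α : Fin (d + 1)) (x z : Fin (d + 1) → ℤ) (β m : Fin (d + 1)) :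
    refK (Φ (d := d) L α) (bhKAt d (toSite (ctrOff (d + 1) L)) L) x z (Sum.inl β) (Sum.inr m) =
      bhKAt d (toSite (ctrOff (d + 1) L)) L x z (Sum.inl β) (Sum.inr m) := by
  rw [refK_apply, Φ_s_inl, Φ_s_inr, Φ_r_inl, Φ_r_inr, bhKAt_inl_inr, bhKAt_inl_inr]
  by_cases hz : Torus.proj L z = 0
  · have hz' : Torus.proj L (mref L α m z) = 0 := (proj_mref_eq_zero_iff α m z).2 hz
    have hq : quo L (mref L α m z) = bref α m (quo L z) := by
      conv_lhs => rw [eq_zsmul_quo_of_proj hz, mref_zsmul]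
      exact quo_zsmul _
    rw [if_pos hz', if_pos hz, hq, linAvgAt_delta1_fref hL]
    have h1 := reflSign_mul_self α β
    have h2 := reflSign_mul_self α m
    linear_combination (-(linAvgAt (toSite (ctrOff (d + 1) L)) (delta1 β x) L m (quo L z)) * (reflSign α m * reflSign α m)) * h1 -
      linAvgAt (toSite (ctrOff (d + 1) L)) (delta1 β x) L m (quo L z) * h2
  · rw [if_neg (fun h => hz ((proj_mref_eq_zero_iff α m z).1 h)), if_neg hz, mul_zero]

/-- [folklore] **THE MULTIPLIER–FIELD BLOCK OF `bhKAt ρ_c L` IS `refK (Φ L α)`-INVARIANT.** -/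
theorem refK_bhKAt_inr_inl {L : ℕ} [NeZero L] (hL : Odd L) (α : Fin (d + 1)) (x z : Fin (d + 1) → ℤ) (m β : Fin (d + 1)) :
    refK (Φ (d := d) L α) (bhKAt d (toSite (ctrOff (d + 1) L)) L) x z (Sum.inr m) (Sum.inl β) =
      bhKAt d (toSite (ctrOff (d + 1) L)) L x z (Sum.inr m) (Sum.inl β) := by
  rw [refK_apply, Φ_s_inl, Φ_s_inr, Φ_r_inl, Φ_r_inr, bhKAt_inr_inl, bhKAt_inr_inl]
  by_cases hx : Torus.proj L x = 0
  · have hx' : Torus.proj L (mref L α m x) = 0 := (proj_mref_eq_zero_iff α m x).2 hx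
    have hq : quo L (mref L α m x) = bref α m (quo L x) := by
      conv_lhs => rw [eq_zsmul_quo_of_proj hx, mref_zsmul]
      exact quo_zsmul _
    rw [if_pos hx', if_pos hx, hq, linAvgAt_delta1_fref hL]
    have h1 := reflSign_mul_self α β
    have h2 := reflSign_mul_self α m
    linear_combination (linAvgAt (toSite (ctrOff (d + 1) L)) (delta1 β z) L m (quo L x) * (reflSign α m * reflSign α m)) * h1 +
      linAvgAt (toSite (ctrOff (d + 1) L)) (delta1 β z) L m (quo L x) * h2
  · rw [if_neg (fun h => hx ((proj_mref_eq_zero_iff α m x).1 h)), if_neg hx, mul_zero]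

/-! ## §2 The cocycle identity of the wall's level-0 border contacts; the border parts `Bwall` -/

section Wall

variable {Lc : ℕ} [NeZero Lc]

/-- [folklore] **THE COCYCLE IDENTITY ON THE FIELD–MULTIPLIER BLOCK**: `(D_α + actB_α D_α′) =fm= (D_α′ + actB_α′ D_α)` for `D := wallD₀ Lc cΛ γ`. -/
theorem comm_wallD₀_inl_inr (hLc : Odd Lc) (cΛ : ℝ) (γ : ℕ → ℝ)
    (hγ : ∀ j, γ j = -((Lc : ℝ) ^ 8 / 2) * wVH 3 Lc j / (stepScale 3 Lc j * (Lc : ℝ) ^ 4)) (α α' κ : Fin 4) (u : Fin 4 → ℤ) (κ' : Fin 4)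
    (u' x z : Fin 4 → ℤ) (β m : Fin 4) :
    (wallD₀ Lc cΛ γ α + actB Lc α (wallD₀ Lc cΛ γ α')) κ u κ' u' x z (Sum.inl β) (Sum.inr m) =
      (wallD₀ Lc cΛ γ α' + actB Lc α' (wallD₀ Lc cΛ γ α)) κ u κ' u' x z (Sum.inl β) (Sum.inr m) := by
  by_cases h : α' = α
  · rw [h]
  exact comm_canonD_of_laws (gα := fun κ u p c => γ 0 * ctGen 3 α Lc κ u p c) (gα' := fun κ u p c => γ 0 * ctGen 3 α' Lc κ u p c)
    (actS_SpureRecAt_zero hLc cΛ γ hγ α) (actS_SpureRecAt_zero hLc cΛ γ hγ α')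
    (fun κ u z b => by
      show γ 0 * ctGen 3 α' Lc κ (bref α κ u) ((Φ (d := 3) Lc α).r b z) b = reflSign α κ * (γ 0 * ctGen 3 α' Lc κ u z b)
      rw [ctGen_fref_of_ne hLc h]; ring)
    (fun κ u z b => by
      show γ 0 * ctGen 3 α Lc κ (bref α' κ u) ((Φ (d := 3) Lc α').r b z) b = reflSign α' κ * (γ 0 * ctGen 3 α Lc κ u z b)
      rw [ctGen_fref_of_ne hLc (Ne.symm h)]; ring)
    (fun x z => by rw [bhKStepAt_zero]; exact refK_bhKAt_inl_inr hLc α x z β m)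
    (fun x z => by rw [bhKStepAt_zero]; exact refK_bhKAt_inl_inr hLc α' x z β m) κ u κ' u' x z

/-- [folklore] **THE COCYCLE IDENTITY ON THE MULTIPLIER–FIELD BLOCK.** -/
theorem comm_wallD₀_inr_inl (hLc : Odd Lc) (cΛ : ℝ) (γ : ℕ → ℝ)
    (hγ : ∀ j, γ j = -((Lc : ℝ) ^ 8 / 2) * wVH 3 Lc j / (stepScale 3 Lc j * (Lc : ℝ) ^ 4)) (α α' κ : Fin 4) (u : Fin 4 → ℤ) (κ' : Fin 4)
    (u' x z : Fin 4 → ℤ) (m β : Fin 4) :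
    (wallD₀ Lc cΛ γ α + actB Lc α (wallD₀ Lc cΛ γ α')) κ u κ' u' x z (Sum.inr m) (Sum.inl β) =
      (wallD₀ Lc cΛ γ α' + actB Lc α' (wallD₀ Lc cΛ γ α)) κ u κ' u' x z (Sum.inr m) (Sum.inl β) := by
  by_cases h : α' = α
  · rw [h]
  exact comm_canonD_of_laws (gα := fun κ u p c => γ 0 * ctGen 3 α Lc κ u p c) (gα' := fun κ u p c => γ 0 * ctGen 3 α' Lc κ u p c)
    (actS_SpureRecAt_zero hLc cΛ γ hγ α) (actS_SpureRecAt_zero hLc cΛ γ hγ α')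
    (fun κ u z b => by
      show γ 0 * ctGen 3 α' Lc κ (bref α κ u) ((Φ (d := 3) Lc α).r b z) b = reflSign α κ * (γ 0 * ctGen 3 α' Lc κ u z b)
      rw [ctGen_fref_of_ne hLc h]; ring)
    (fun κ u z b => by
      show γ 0 * ctGen 3 α Lc κ (bref α' κ u) ((Φ (d := 3) Lc α').r b z) b = reflSign α' κ * (γ 0 * ctGen 3 α Lc κ u z b)
      rw [ctGen_fref_of_ne hLc (Ne.symm h)]; ring)
    (fun x z => by rw [bhKStepAt_zero]; exact refK_bhKAt_inr_inl hLc α x z m β)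
    (fun x z => by rw [bhKStepAt_zero]; exact refK_bhKAt_inr_inl hLc α' x z m β) κ u κ' u' x z

/-- [our object] **THE BORDER PART OF THE LEVEL-0 CONTACT OF AXIS `α`**: `Bwall Lc cΛ γ α := bdB (wallD₀ Lc cΛ γ α)`. -/
def Bwall (Lc : ℕ) [NeZero Lc] (cΛ : ℝ) (γ : ℕ → ℝ) (α : Fin 4) : Fin 4 → (Fin 4 → ℤ) → Fin 4 → (Fin 4 → ℤ) → MKer 4 (Fib 3) :=
  bdB (wallD₀ Lc cΛ γ α)

/-- [folklore] `Bwall α` is `α`-anti-invariant. -/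
theorem actB_Bwall (hLc : Odd Lc) (cΛ : ℝ) (γ : ℕ → ℝ)
    (hγ : ∀ j, γ j = -((Lc : ℝ) ^ 8 / 2) * wVH 3 Lc j / (stepScale 3 Lc j * (Lc : ℝ) ^ 4)) (α : Fin 4) :
    actB Lc α (Bwall Lc cΛ γ α) = -Bwall Lc cΛ γ α :=
  actB_bdB_of_anti α (actB_wallD₀ hLc cΛ γ hγ α)

/-- [folklore] **THE COCYCLE IDENTITY OF THE BORDER PARTS** (an equality of bi-tables): `B_α + actB_α B_α′ = B_α′ + actB_α′ B_α`. -/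
theorem comm_Bwall (hLc : Odd Lc) (cΛ : ℝ) (γ : ℕ → ℝ)
    (hγ : ∀ j, γ j = -((Lc : ℝ) ^ 8 / 2) * wVH 3 Lc j / (stepScale 3 Lc j * (Lc : ℝ) ^ 4)) (α α' : Fin 4) :
    Bwall Lc cΛ γ α + actB Lc α (Bwall Lc cΛ γ α') = Bwall Lc cΛ γ α' + actB Lc α' (Bwall Lc cΛ γ α) := by
  unfold Bwall
  rw [actB_bdB, actB_bdB]
  funext κ u κ' u' x z a b
  have hfm := comm_wallD₀_inl_inr hLc cΛ γ hγ α α' κ u κ' u' x z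
  have hmf := comm_wallD₀_inr_inl hLc cΛ γ hγ α α' κ u κ' u' x z
  simp only [Pi.add_apply] at hfm hmf ⊢
  rcases a with β | m <;> rcases b with β' | m'
  · simp [bdB, bd]
  · simp only [bdB_inl_inr]; exact hfm β m'
  · simp only [bdB_inr_inl]; exact hmf m β'
  · simp [bdB, bd]

/-- [folklore] `Bwall α` has no field–field block. -/
theorem Bwall_inl_inl (cΛ : ℝ) (γ : ℕ → ℝ) (α κ : Fin 4) (u : Fin 4 → ℤ) (κ' : Fin 4) (u' x z : Fin 4 → ℤ) (β β' : Fin 4) :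
    Bwall Lc cΛ γ α κ u κ' u' x z (Sum.inl β) (Sum.inl β') = 0 := rfl

/-- [folklore] `Bwall α` has no multiplier–multiplier block. -/
theorem Bwall_inr_inr (cΛ : ℝ) (γ : ℕ → ℝ) (α κ : Fin 4) (u : Fin 4 → ℤ) (κ' : Fin 4) (u' x z : Fin 4 → ℤ) (m m' : Fin 4) :
    Bwall Lc cΛ γ α κ u κ' u' x z (Sum.inr m) (Sum.inr m') = 0 := rfl

/-- [folklore] `Bwall α` is anti-twin on the border (the canonical contact is: `SecondOrderBorderNoModel.conjW_canon_antiTwin`, with the wall's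
parities `trK_SpureRecAt_zero` (odd ⇒ twin border) and `trK_bhKStepAt` (even ⇒ anti-twin border)). -/
theorem Bwall_antiTwin (cΛ : ℝ) (γ : ℕ → ℝ) (α κ : Fin 4) (u : Fin 4 → ℤ) (κ' : Fin 4) (u' x z : Fin 4 → ℤ) (β m : Fin 4) :
    Bwall Lc cΛ γ α κ u κ' u' z x (Sum.inr m) (Sum.inl β) = -Bwall Lc cΛ γ α κ u κ' u' x z (Sum.inl β) (Sum.inr m) := by
  show wallD₀ Lc cΛ γ α κ u κ' u' z x (Sum.inr m) (Sum.inl β) = -wallD₀ Lc cΛ γ α κ u κ' u' x z (Sum.inl β) (Sum.inr m)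
  rw [wallD₀_eq]
  have e : (fun p c => γ 0 ^ 2 * (ctGen 3 α Lc κ u p c * ctGen 3 α Lc κ' u' p c)) =
      fun p c => γ 0 * ctGen 3 α Lc κ u p c * (γ 0 * ctGen 3 α Lc κ' u' p c) := by
    funext p c; ring
  rw [e]
  exact conjW_canon_antiTwin
    (fun x z β m => twin_of_parityOdd (trK_SpureRecAt_zero (toSite (ctrOff 4 Lc)) _ _ cΛ κ u) x z β m)
    (fun x z β m => twin_of_parityOdd (trK_SpureRecAt_zero (toSite (ctrOff 4 Lc)) _ _ cΛ κ' u') x z β m)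
    (fun x z β m => antiTwin_of_parityEven (trK_bhKStepAt (toSite (ctrOff 4 Lc)) Lc 0) x z β m) x z β m

/-! ## §3 The four-axis table `Twall` -/

/-- [our object] **THE MODEL TABLE** (weight-free): the four sequential steps over the axes `0, 1, 2, 3` starting from `0`. -/
def Twall (Lc : ℕ) [NeZero Lc] (cΛ : ℝ) (γ : ℕ → ℝ) : Fin 4 → (Fin 4 → ℤ) → Fin 4 → (Fin 4 → ℤ) → MKer 4 (Fib 3) :=
  stepB Lc 3 (Bwall Lc cΛ γ 3) (stepB Lc 2 (Bwall Lc cΛ γ 2) (stepB Lc 1 (Bwall Lc cΛ γ 1) (stepB Lc 0 (Bwall Lc cΛ γ 0) 0)))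

/-- [folklore] **`Twall` SOLVES ALL FOUR AXES**: `actB Lc α Twall − Twall = Bwall α`. -/
theorem Twall_solves (hLc : Odd Lc) (cΛ : ℝ) (γ : ℕ → ℝ)
    (hγ : ∀ j, γ j = -((Lc : ℝ) ^ 8 / 2) * wVH 3 Lc j / (stepScale 3 Lc j * (Lc : ℝ) ^ 4)) (α : Fin 4) :
    actB Lc α (Twall Lc cΛ γ) - Twall Lc cΛ γ = Bwall Lc cΛ γ α := by
  have hA := actB_Bwall hLc cΛ γ hγ
  have hC := comm_Bwall hLc cΛ γ hγ
  -- after step k the axes 0 … k are solved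
  have s10 : actB Lc 0 (stepB Lc 0 (Bwall Lc cΛ γ 0) 0) - stepB Lc 0 (Bwall Lc cΛ γ 0) 0 = Bwall Lc cΛ γ 0 :=
    stepB_solves_self (hA 0) 0
  have s21 := stepB_solves_self (hA 1) (stepB Lc 0 (Bwall Lc cΛ γ 0) 0)
  have s20 := stepB_solves_other s10 (hC 1 0)
  have s32 := stepB_solves_self (hA 2) (stepB Lc 1 (Bwall Lc cΛ γ 1) (stepB Lc 0 (Bwall Lc cΛ γ 0) 0))
  have s31 := stepB_solves_other s21 (hC 2 1)
  have s30 := stepB_solves_other s20 (hC 2 0)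
  have s43 := stepB_solves_self (hA 3) (stepB Lc 2 (Bwall Lc cΛ γ 2) (stepB Lc 1 (Bwall Lc cΛ γ 1) (stepB Lc 0 (Bwall Lc cΛ γ 0) 0)))
  have s42 := stepB_solves_other s32 (hC 3 2)
  have s41 := stepB_solves_other s31 (hC 3 1)
  have s40 := stepB_solves_other s30 (hC 3 0)
  unfold Twall
  fin_cases α
  · exact s40
  · exact s41
  · exact s42
  · exact s43

/-- [folklore] `Twall` has no field–field block. -/
theorem Twall_inl_inl (cΛ : ℝ) (γ : ℕ → ℝ) (κ : Fin 4) (u : Fin 4 → ℤ) (κ' : Fin 4) (u' x z : Fin 4 → ℤ) (β β' : Fin 4) :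
    Twall Lc cΛ γ κ u κ' u' x z (Sum.inl β) (Sum.inl β') = 0 := by
  unfold Twall
  refine stepB_apply_eq_zero 3 (Bwall_inl_inl cΛ γ 3 · · · · · · β β')
    (stepB_apply_eq_zero 2 (Bwall_inl_inl cΛ γ 2 · · · · · · β β')
      (stepB_apply_eq_zero 1 (Bwall_inl_inl cΛ γ 1 · · · · · · β β')
        (stepB_apply_eq_zero 0 (Bwall_inl_inl cΛ γ 0 · · · · · · β β') (fun _ _ _ _ _ _ => rfl)))) κ u κ' u' x z

/-- [folklore] `Twall` has no multiplier–multiplier block. -/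
theorem Twall_inr_inr (cΛ : ℝ) (γ : ℕ → ℝ) (κ : Fin 4) (u : Fin 4 → ℤ) (κ' : Fin 4) (u' x z : Fin 4 → ℤ) (m m' : Fin 4) :
    Twall Lc cΛ γ κ u κ' u' x z (Sum.inr m) (Sum.inr m') = 0 := by
  unfold Twall
  refine stepB_apply_eq_zero 3 (Bwall_inr_inr cΛ γ 3 · · · · · · m m')
    (stepB_apply_eq_zero 2 (Bwall_inr_inr cΛ γ 2 · · · · · · m m')
      (stepB_apply_eq_zero 1 (Bwall_inr_inr cΛ γ 1 · · · · · · m m')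
        (stepB_apply_eq_zero 0 (Bwall_inr_inr cΛ γ 0 · · · · · · m m') (fun _ _ _ _ _ _ => rfl)))) κ u κ' u' x z

/-- [folklore] `Twall` is anti-twin on the border. -/
theorem Twall_antiTwin (cΛ : ℝ) (γ : ℕ → ℝ) (κ : Fin 4) (u : Fin 4 → ℤ) (κ' : Fin 4) (u' x z : Fin 4 → ℤ) (β m : Fin 4) :
    Twall Lc cΛ γ κ u κ' u' z x (Sum.inr m) (Sum.inl β) = -Twall Lc cΛ γ κ u κ' u' x z (Sum.inl β) (Sum.inr m) := by
  unfold Twall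
  refine antiTwin_stepB 3 (Bwall_antiTwin cΛ γ 3)
    (antiTwin_stepB 2 (Bwall_antiTwin cΛ γ 2)
      (antiTwin_stepB 1 (Bwall_antiTwin cΛ γ 1)
        (antiTwin_stepB 0 (Bwall_antiTwin cΛ γ 0) (fun _ _ _ _ _ _ _ _ => by simp)))) κ u κ' u' x z β m

/-! ## §4 The model of the END's border socket -/

/-- [our object] **THE MODEL BORDER TABLE** `vh₂SModel Lc cΛ cB γ := cB⁻¹ • Twall Lc cΛ γ` (border weight `cB ≠ 0`). -/
def vh₂SModel (Lc : ℕ) [NeZero Lc] (cΛ cB : ℝ) (γ : ℕ → ℝ) : Fin 4 → (Fin 4 → ℤ) → Fin 4 → (Fin 4 → ℤ) → MKer 4 (Fib 3) :=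
  cB⁻¹ • Twall Lc cΛ γ

/-- [folklore] **THE MODEL SATISFIES THE END's BORDER LETTER AT LEVEL `0`, ALL FOUR AXES** (K-I's (hBe), `j := 0`, VERBATIM via an3's `BorderAt`). -/
theorem borderAt_zero_vh₂SModel (hLc : Odd Lc) (cΛ cB : ℝ) (hcB : cB ≠ 0) (γ : ℕ → ℝ)
    (hγ : ∀ j, γ j = -((Lc : ℝ) ^ 8 / 2) * wVH 3 Lc j / (stepScale 3 Lc j * (Lc : ℝ) ^ 4)) :
    BorderAt Lc (toSite (ctrOff 4 Lc)) cΛ cB γ (vh₂SModel Lc cΛ cB γ) 0 := by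
  intro α κ u κ' u' x z β m
  have hw : wB2 3 Lc 0 = 1 := by simp [BalabanStepW2.wB2]
  -- the weighted model table is `Twall`
  have hG : (fun κ u κ' u' => (cB * wB2 3 Lc 0) • vh₂SModel Lc cΛ cB γ κ u κ' u') = Twall Lc cΛ γ := by
    funext κ u κ' u'
    rw [hw, mul_one]
    show cB • (cB⁻¹ • Twall Lc cΛ γ) κ u κ' u' = Twall Lc cΛ γ κ u κ' u'
    rw [Pi.smul_apply, Pi.smul_apply, Pi.smul_apply, Pi.smul_apply, smul_smul, mul_inv_cancel₀ hcB, one_smul]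
  have hsol := Twall_solves hLc cΛ γ hγ α
  rw [← hG] at hsol
  rw [← wallD₀_eq]
  revert x z
  rw [letter_iff_actB Lc α (fun κ u κ' u' => (cB * wB2 3 Lc 0) • vh₂SModel Lc cΛ cB γ κ u κ' u') (wallD₀ Lc cΛ γ α)
    κ u κ' u' (Sum.inl β) (Sum.inr m)]
  intro x z
  have e := congrFun (congrFun (congrFun (congrFun hsol κ) u) κ') u'
  simp only [Pi.sub_apply] at e
  rw [e]
  rfl

/-- [folklore] The model has no field–field block (the END's `hB0`). -/
theorem vh₂SModel_inl_inl (cΛ cB : ℝ) (γ : ℕ → ℝ) (κ : Fin 4) (u : Fin 4 → ℤ) (κ' : Fin 4) (u' x z : Fin 4 → ℤ) (β β' : Fin 4) :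
    vh₂SModel Lc cΛ cB γ κ u κ' u' x z (Sum.inl β) (Sum.inl β') = 0 := by
  simp [vh₂SModel, Twall_inl_inl]

/-- [folklore] The model has no multiplier–multiplier block (the END's `hBmm0`). -/
theorem vh₂SModel_inr_inr (cΛ cB : ℝ) (γ : ℕ → ℝ) (κ : Fin 4) (u : Fin 4 → ℤ) (κ' : Fin 4) (u' x z : Fin 4 → ℤ) (m m' : Fin 4) :
    vh₂SModel Lc cΛ cB γ κ u κ' u' x z (Sum.inr m) (Sum.inr m') = 0 := by
  simp [vh₂SModel, Twall_inr_inr]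

/-- [folklore] The model is anti-twin on the border (the END's `hBat`). -/
theorem vh₂SModel_antiTwin (cΛ cB : ℝ) (γ : ℕ → ℝ) (κ : Fin 4) (u : Fin 4 → ℤ) (κ' : Fin 4) (u' x z : Fin 4 → ℤ) (β m : Fin 4) :
    vh₂SModel Lc cΛ cB γ κ u κ' u' z x (Sum.inr m) (Sum.inl β) = -vh₂SModel Lc cΛ cB γ κ u κ' u' x z (Sum.inl β) (Sum.inr m) := by
  simp [vh₂SModel, Twall_antiTwin]

end Wall

end

end Summit.QuantumFields.BalabanUV.Beta.SecondOrderBorderModel
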